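import Summits.AnomalousDissipation.AnomalousDissipation.Theses.TameRoughRigidity
import Summits.AnomalousDissipation.AnomalousDissipation.Theorems.GPStatisticalRigidity.Negative.EulerSSS
import Summits.AnomalousDissipation.AnomalousDissipation.Theorems.GPEulerCoercive.Negative.RestState
import Summits.AnomalousDissipation.AnomalousDissipation.Theorems.EnsembleRigidityGPStatisticalRigidityDesaturation

/-!
# `TameRoughRigidity.GPEulerCoercive` (stmt-AnomalousDissipation-18400) — load-bearing clauses of the FMRT class
# and the time-reversal normal form (negative side)

cdisprove seat `refuter-cdisprove-stmt-AnomalousDissipation-18400-0`, cycle 1 (2026-08-17). The crux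
`N = GPEulerCoercive` reads `∀ μ, ¬ IsStationaryStatisticalSolution 0 f_GP μ`; at `ν = 0` the FMRT structure is the
conjunction of FOUR clauses

  prob (`IsProbabilityMeasure μ`) ∧ fin (`∫⁻ ‖∇u‖² dμ < ∞`) ∧ liouville (`∀ Φ, ∫⟨f − B(u,u), Φ'(u)⟩ dμ = 0`,
  integrand integrable) ∧ shell (`∫_{e₁ ≤ |u|² < e₂} (0·‖∇u‖² − (u, f)) dμ ≤ 0`).

Since `N` NEGATES the conjunction, deleting a clause makes `N` STRONGER; "clause `H` is load-bearing" means
`N`-without-`H` is FALSE, i.e. some measure meets the other three clauses. Kernel-checked here (no definition is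
introduced and no Theses statement is asserted; the clauses are written out verbatim):

* `gpEulerCoercive_false_without_prob` — the ZERO MEASURE meets fin ∧ liouville ∧ shell.
* `gpEulerCoercive_false_without_liouville` — the Dirac mass AT REST meets prob ∧ fin ∧ shell (`(0, f) = 0`); only
  the Liouville identity (tested on `Φ' = f_GP`, `(f_GP, f_GP) = 3/2`) excludes it.
* **shell is NOT load-bearing** (`gpEulerCoercive_iff_withoutShell`, `gpEulerCoercive_iff_noLiouville`): forced Euler is
  time-reversible — `⟨F(−u), w⟩ = ⟨F(u), w⟩`, `D(−·) = −1` — so for ANY probability measure `μ` of finite mean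
  enstrophy killing every cylindrical generator image, the symmetrisation `μˢ = ½μ + ½(−)_*μ` is a stationary
  statistical solution of forced Euler in the full FMRT sense with ZERO work on every shell
  (`isSSS_symmetrize`, `shellWork_symmetrize_eq_zero`; STRATEGY-CENSUS F1, now kernel-checked for `N` itself —
  the parent crux has the analogous `stub_desaturation` for the rigidity inequality). Consequently `N` is
  EQUIVALENT to the pure Liouville non-existence statement "no probability measure on `H` with `∫‖∇u‖² dμ < ∞`
  satisfies `∫⟨f_GP − B(u,u), Φ'(u)⟩ dμ = 0` for all cylindrical `Φ`" — exactly what the weak-duality stub W of line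
  `floor-duality-galerkin` consumes — and WLOG an Euler statistics of `f_GP` is EVEN (`exists_even_sss_of_not_gpEulerCoercive`).
* fin is load-bearing in spirit only: deleting it admits Dirac masses at wild (convex-integration, infinite-enstrophy)
  steady weak solutions of forced Euler — not constructible in the tree; no lemma.
* `not_gpEulerCoercive_iff`, `not_gpEulerCoercive_of_steadyWeakEuler`, `not_gpStatisticalRigidity_of_not_gpEulerCoercive` —
  the kill switch in the crux's own vocabulary: `¬N` is EXACTLY one stationary Euler statistics of `f_GP`, in particular one
  steady `H`-weak Euler state `u ∈ V = H ∩ H¹` with `P(u·∇u) = f_GP` (finite enstrophy only, any energy), and it kills the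
  route target `X` with it. None is known (parent census: no exact finite-mode dodger of `f_GP`).
-/

noncomputable section

open MeasureTheory UnitAddTorus
open scoped InnerProductSpace ENNReal

set_option linter.dupNamespace false

namespace Summit.AnomalousDissipation.AnomalousDissipation.Theorems.GPEulerCoercive.Negative

open Literature.Analysis.FunctionSpaces Literature.Analysis.FunctionSpaces.Torus Literature.Analysis.FluidPDE
open Summit.AnomalousDissipation.AnomalousDissipation.Theses.TameRoughRigidity
open Summit.AnomalousDissipation.AnomalousDissipation.Theorems.GPStatisticalRigidity.Negative
open Summit.AnomalousDissipation.AnomalousDissipation.Theorems.TaylorCertificatePair.Negative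
  (pairing_of_ae eGradNormSq_coe_zero)
open Summit.AnomalousDissipation.AnomalousDissipation.Theorems.EnsembleRigidity.GPStatisticalRigidity
  (desaturation_generator_neg_left desaturation_generator_neg_right desaturation_eGradNormSq_neg
    desaturation_exists_reflect)

/-! ## §1 The crux unfolded at the pinned force -/

/-- The crux, unfolded at the pinned force `f_GP`. -/
theorem gpEulerCoercive_iff :
    GPEulerCoercive ↔ ∀ μ : Measure (Torus.energySpace (Fin 3)),
      ¬ Torus.IsStationaryStatisticalSolution 0 gpForce μ :=
  ⟨fun h μ => h gpForce rfl μ, fun h f hf μ => by subst hf; exact h μ⟩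

/-! ## §2 Load-bearing: the probability normalisation -/

/-- **Any proof of `N` must use the mass normalisation**: with clause prob deleted, the ZERO MEASURE has finite
(zero) mean enstrophy, kills every generator image and does no shell work. -/
theorem gpEulerCoercive_false_without_prob :
    ¬ ∀ μ : Measure (Torus.energySpace (Fin 3)),
      ¬ ((∫⁻ u, Torus.eGradNormSq ((u : Lp (EuclideanSpace ℝ (Fin 3)) 2 (volume : Measure (UnitAddTorus (Fin 3)))) :
            UnitAddTorus (Fin 3) → EuclideanSpace ℝ (Fin 3)) ∂μ < ∞) ∧
        (∀ Φ : Torus.CylindricalTest (Fin 3),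
          Integrable (fun u : Torus.energySpace (Fin 3) => Torus.nsGeneratorPairing 0 gpForce u (Φ.grad u)) μ ∧
            ∫ u, Torus.nsGeneratorPairing 0 gpForce u (Φ.grad u) ∂μ = 0) ∧
        (∀ e₁ e₂ : ℝ≥0∞, e₁ < e₂ →
          ∫ u in {u : Torus.energySpace (Fin 3) | e₁ ≤ ‖u‖ₑ ^ 2 ∧ ‖u‖ₑ ^ 2 < e₂},
            (0 * (Torus.eGradNormSq ((u : Lp (EuclideanSpace ℝ (Fin 3)) 2 (volume : Measure (UnitAddTorus (Fin 3)))) :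
              UnitAddTorus (Fin 3) → EuclideanSpace ℝ (Fin 3))).toReal -
              Torus.pairing (u : Lp (EuclideanSpace ℝ (Fin 3)) 2 (volume : Measure (UnitAddTorus (Fin 3)))) gpForce) ∂μ ≤ 0)) := by
  intro h
  refine h 0 ⟨by simp, fun Φ => ⟨integrable_zero_measure, by simp⟩, fun e₁ e₂ _ => by simp⟩

/-! ## §3 Load-bearing: the Liouville identity -/

/-- **Any proof of `N` must use the Liouville identity**: with clause liouville deleted, the Dirac mass at rest is
a probability measure of zero mean enstrophy and zero shell work (`(0, f_GP) = 0`). -/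
theorem gpEulerCoercive_false_without_liouville :
    ¬ ∀ μ : Measure (Torus.energySpace (Fin 3)),
      ¬ (IsProbabilityMeasure μ ∧
        (∫⁻ u, Torus.eGradNormSq ((u : Lp (EuclideanSpace ℝ (Fin 3)) 2 (volume : Measure (UnitAddTorus (Fin 3)))) :
            UnitAddTorus (Fin 3) → EuclideanSpace ℝ (Fin 3)) ∂μ < ∞) ∧
        (∀ e₁ e₂ : ℝ≥0∞, e₁ < e₂ →
          ∫ u in {u : Torus.energySpace (Fin 3) | e₁ ≤ ‖u‖ₑ ^ 2 ∧ ‖u‖ₑ ^ 2 < e₂},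
            (0 * (Torus.eGradNormSq ((u : Lp (EuclideanSpace ℝ (Fin 3)) 2 (volume : Measure (UnitAddTorus (Fin 3)))) :
              UnitAddTorus (Fin 3) → EuclideanSpace ℝ (Fin 3))).toReal -
              Torus.pairing (u : Lp (EuclideanSpace ℝ (Fin 3)) 2 (volume : Measure (UnitAddTorus (Fin 3)))) gpForce) ∂μ ≤ 0)) := by
  intro h
  refine h (Measure.dirac (0 : Torus.energySpace (Fin 3))) ⟨inferInstance, ?_, ?_⟩
  · rw [lintegral_dirac, eGradNormSq_coe_zero]
    exact ENNReal.zero_lt_top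
  · intro e₁ e₂ _
    refine integral_nonpos_of_ae (ae_restrict_of_ae ?_)
    filter_upwards [ae_eq_dirac (fun u : Torus.energySpace (Fin 3) =>
      (0 * (Torus.eGradNormSq ((u : Lp (EuclideanSpace ℝ (Fin 3)) 2 (volume : Measure (UnitAddTorus (Fin 3)))) :
        UnitAddTorus (Fin 3) → EuclideanSpace ℝ (Fin 3))).toReal -
        Torus.pairing (u : Lp (EuclideanSpace ℝ (Fin 3)) 2 (volume : Measure (UnitAddTorus (Fin 3)))) gpForce))] with u hu
    rw [hu, pairing_zero_state]
    simp

/-! ## §4 The kill switch in the crux's own words -/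

/-- `¬N` is exactly the existence of ONE stationary statistical solution of Euler forced by `f_GP`. -/
theorem not_gpEulerCoercive_iff :
    ¬ GPEulerCoercive ↔ ∃ μ : Measure (Torus.energySpace (Fin 3)),
      Torus.IsStationaryStatisticalSolution 0 gpForce μ := by
  rw [gpEulerCoercive_iff]
  push Not
  rfl

/-- **Kill switch (finite-enstrophy dodger).** ONE steady `H`-weak solution of Euler forced by `f_GP` in
`V = H ∩ H¹` (finite enstrophy, no smoothness, any energy) refutes `N` (Dirac mass, FMRT IV §1.2). -/
theorem not_gpEulerCoercive_of_steadyWeakEuler {u : Torus.energySpace (Fin 3)}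
    (hV : (u : Lp (EuclideanSpace ℝ (Fin 3)) 2 (volume : Measure (UnitAddTorus (Fin 3)))) ∈ Torus.energySpaceV (Fin 3))
    (hu : Torus.IsSteadyWeakSolution 0 gpForce u) : ¬ GPEulerCoercive :=
  not_gpEulerCoercive_iff.mpr ⟨_, Torus.isStationaryStatisticalSolution_dirac_holds le_rfl memLp_gpForce (by simp) hV hu⟩

/-- Every refutation of `N` refutes the route target `X = GPStatisticalRigidity` (this route's byte-identical copy):
`N` is NECESSARY for `X` (the landed `not_gpStatisticalRigidity_of_eulerSSS`). -/
theorem not_gpStatisticalRigidity_of_not_gpEulerCoercive (h : ¬ GPEulerCoercive) : ¬ GPStatisticalRigidity := by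
  obtain ⟨μ, hμ⟩ := not_gpEulerCoercive_iff.mp h
  exact not_gpStatisticalRigidity_of_eulerSSS hμ

/-! ## §5 The shell clause is idle: time reversal `u ↦ −u`

`(−)_*` is implemented by the measurable automorphism `MeasurableEquiv.neg H`; the symmetrised measure is written
out as `2⁻¹ • μ + 2⁻¹ • μ.map (MeasurableEquiv.neg H)`. -/

/-- The representative of `−u` is a.e. `−`(the representative of `u`). -/
theorem coe_neg_ae (u : Torus.energySpace (Fin 3)) :
    (((-u : Torus.energySpace (Fin 3)) : Lp (EuclideanSpace ℝ (Fin 3)) 2 (volume : Measure (UnitAddTorus (Fin 3)))) :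
        UnitAddTorus (Fin 3) → EuclideanSpace ℝ (Fin 3)) =ᵐ[volume]
      fun x => -(((u : Torus.energySpace (Fin 3)) : Lp (EuclideanSpace ℝ (Fin 3)) 2 (volume : Measure (UnitAddTorus (Fin 3)))) :
        UnitAddTorus (Fin 3) → EuclideanSpace ℝ (Fin 3)) x := by
  rw [Submodule.coe_neg]
  exact Lp.coeFn_neg _

/-- The work functional is odd in the state for EVERY field `f` (no integrability needed: junk `0 = −0`). -/
theorem pairing_neg_state (u : Torus.energySpace (Fin 3)) (f : UnitAddTorus (Fin 3) → EuclideanSpace ℝ (Fin 3)) :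
    Torus.pairing ((-u : Torus.energySpace (Fin 3)) : Lp (EuclideanSpace ℝ (Fin 3)) 2 (volume : Measure (UnitAddTorus (Fin 3)))) f =
      -Torus.pairing ((u : Torus.energySpace (Fin 3)) : Lp (EuclideanSpace ℝ (Fin 3)) 2 (volume : Measure (UnitAddTorus (Fin 3)))) f := by
  rw [pairing_of_ae (coe_neg_ae u)]
  unfold Torus.pairing
  rw [← integral_neg]
  refine integral_congr_ae (ae_of_all _ fun x => ?_)
  simp only [inner_neg_left]

/-- **Reversibility of the Liouville integrand.** For every cylindrical `Φ` there is a cylindrical `Ψ` (same test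
fields, reflected profile) with `⟨F(−u), Φ'(−u)⟩ = −⟨F(u), Ψ'(u)⟩` for all states `u`. -/
theorem exists_generator_comp_neg (f : UnitAddTorus (Fin 3) → EuclideanSpace ℝ (Fin 3)) (Φ : Torus.CylindricalTest (Fin 3)) :
    ∃ Ψ : Torus.CylindricalTest (Fin 3), ∀ u : Torus.energySpace (Fin 3),
      Torus.nsGeneratorPairing 0 f (-u) (Φ.grad (-u)) = -Torus.nsGeneratorPairing 0 f u (Ψ.grad u) := by
  obtain ⟨Ψ, hΨ⟩ := desaturation_exists_reflect Φ
  refine ⟨Ψ, fun u => ?_⟩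
  have hgrad : Φ.grad (-u) = fun x => -Ψ.grad u x := by
    funext x; rw [hΨ u]; simp
  rw [hgrad, desaturation_generator_neg_right, desaturation_generator_neg_left]

/-- **Time-reversal symmetrisation.** A probability measure on `H` of finite mean enstrophy that kills every
cylindrical forced-Euler generator image symmetrises, `μˢ = ½μ + ½(−)_*μ`, to a stationary statistical solution of
forced Euler in the full FMRT sense (any force `f`; the shell inequality of `μˢ` holds with equality). -/
theorem isSSS_symmetrize {f : UnitAddTorus (Fin 3) → EuclideanSpace ℝ (Fin 3)} {μ : Measure (Torus.energySpace (Fin 3))}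
    [IsProbabilityMeasure μ]
    (hfin : ∫⁻ u, Torus.eGradNormSq ((u : Lp (EuclideanSpace ℝ (Fin 3)) 2 (volume : Measure (UnitAddTorus (Fin 3)))) :
      UnitAddTorus (Fin 3) → EuclideanSpace ℝ (Fin 3)) ∂μ < ∞)
    (hL : ∀ Φ : Torus.CylindricalTest (Fin 3),
      Integrable (fun u : Torus.energySpace (Fin 3) => Torus.nsGeneratorPairing 0 f u (Φ.grad u)) μ ∧
        ∫ u, Torus.nsGeneratorPairing 0 f u (Φ.grad u) ∂μ = 0) :
    Torus.IsStationaryStatisticalSolution 0 f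
      ((2 : ℝ≥0∞)⁻¹ • μ + (2 : ℝ≥0∞)⁻¹ • μ.map (MeasurableEquiv.neg (Torus.energySpace (Fin 3)))) := by
  set T := MeasurableEquiv.neg (Torus.energySpace (Fin 3)) with hT
  have hTapply : ∀ u : Torus.energySpace (Fin 3), T u = -u := fun u => rfl
  have two_ne_top : (2 : ℝ≥0∞)⁻¹ ≠ ∞ := by simp
  haveI : IsProbabilityMeasure (μ.map T) := Measure.isProbabilityMeasure_map T.measurable.aemeasurable
  refine ⟨?_, ?_, ?_, ?_⟩
  · -- probability
    constructor
    simp only [Measure.add_apply, Measure.smul_apply, measure_univ, smul_eq_mul, mul_one]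
    exact ENNReal.inv_two_add_inv_two
  · -- finite mean enstrophy: the density is even
    simp only [lintegral_add_measure, lintegral_smul_measure]
    rw [lintegral_map_equiv]
    simp only [hTapply, desaturation_eGradNormSq_neg]
    exact ENNReal.add_lt_top.mpr ⟨ENNReal.mul_lt_top (by simp) hfin, ENNReal.mul_lt_top (by simp) hfin⟩
  · -- Liouville: the reflected test functional
    intro Φ
    obtain ⟨hi, h0⟩ := hL Φ
    obtain ⟨Ψ, hΨ⟩ := exists_generator_comp_neg f Φ
    obtain ⟨hi', h0'⟩ := hL Ψ
    have hcomp : ((fun u : Torus.energySpace (Fin 3) => Torus.nsGeneratorPairing 0 f u (Φ.grad u)) ∘ T) =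
        fun u : Torus.energySpace (Fin 3) => -Torus.nsGeneratorPairing 0 f u (Ψ.grad u) := by
      funext u; simp only [Function.comp_apply, hTapply]; exact hΨ u
    have hmap : Integrable (fun u : Torus.energySpace (Fin 3) => Torus.nsGeneratorPairing 0 f u (Φ.grad u)) (μ.map T) := by
      rw [integrable_map_equiv, hcomp]; exact hi'.neg
    refine ⟨(hi.smul_measure two_ne_top).add_measure (hmap.smul_measure two_ne_top), ?_⟩
    rw [integral_add_measure (hi.smul_measure two_ne_top) (hmap.smul_measure two_ne_top),
      integral_smul_measure, integral_smul_measure, integral_map_equiv]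
    change _ + _ • ∫ u, ((fun u : Torus.energySpace (Fin 3) => Torus.nsGeneratorPairing 0 f u (Φ.grad u)) ∘ T) u ∂μ = 0
    rw [hcomp, integral_neg, h0, h0']
    simp
  · -- shell inequality: the work is odd, the shells are even
    intro e₁ e₂ _
    set S : Set (Torus.energySpace (Fin 3)) := {u | e₁ ≤ ‖u‖ₑ ^ 2 ∧ ‖u‖ₑ ^ 2 < e₂} with hS
    set g : Torus.energySpace (Fin 3) → ℝ := fun u =>
      0 * (Torus.eGradNormSq ((u : Lp (EuclideanSpace ℝ (Fin 3)) 2 (volume : Measure (UnitAddTorus (Fin 3)))) :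
        UnitAddTorus (Fin 3) → EuclideanSpace ℝ (Fin 3))).toReal -
        Torus.pairing (u : Lp (EuclideanSpace ℝ (Fin 3)) 2 (volume : Measure (UnitAddTorus (Fin 3)))) f with hg
    have hgneg : ∀ u : Torus.energySpace (Fin 3), g (T u) = -g u := fun u => by
      simp only [hg, hTapply, zero_mul, zero_sub, pairing_neg_state, neg_neg]
    have hpre : T ⁻¹' S = S := by
      ext u
      simp only [hS, Set.mem_preimage, Set.mem_setOf_eq, hTapply, enorm_neg]
    have hrestr : ((2 : ℝ≥0∞)⁻¹ • μ + (2 : ℝ≥0∞)⁻¹ • μ.map T).restrict S =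
        (2 : ℝ≥0∞)⁻¹ • μ.restrict S + (2 : ℝ≥0∞)⁻¹ • (μ.restrict S).map T := by
      simp only [Measure.restrict_add, Measure.restrict_smul]
      rw [T.measurableEmbedding.restrict_map, hpre]
    change ∫ u in S, g u ∂((2 : ℝ≥0∞)⁻¹ • μ + (2 : ℝ≥0∞)⁻¹ • μ.map T) ≤ 0
    rw [hrestr]
    by_cases hint : Integrable g ((2 : ℝ≥0∞)⁻¹ • μ.restrict S + (2 : ℝ≥0∞)⁻¹ • (μ.restrict S).map T)
    · have h1 : Integrable g ((2 : ℝ≥0∞)⁻¹ • μ.restrict S) := hint.mono_measure (Measure.le_add_right le_rfl)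
      have h2 : Integrable g ((2 : ℝ≥0∞)⁻¹ • (μ.restrict S).map T) := hint.mono_measure (Measure.le_add_left le_rfl)
      rw [integral_add_measure h1 h2, integral_smul_measure, integral_smul_measure, integral_map_equiv]
      simp only [hgneg, integral_neg, smul_eq_mul, mul_neg, add_neg_cancel, le_refl]
    · rw [integral_undef hint]

/-- The symmetrised measure does ZERO work on every shell (not merely `≤ 0`), for every field `f`. -/
theorem shellWork_symmetrize_eq_zero (f : UnitAddTorus (Fin 3) → EuclideanSpace ℝ (Fin 3))
    (μ : Measure (Torus.energySpace (Fin 3))) (e₁ e₂ : ℝ≥0∞) :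
    ∫ u in {u : Torus.energySpace (Fin 3) | e₁ ≤ ‖u‖ₑ ^ 2 ∧ ‖u‖ₑ ^ 2 < e₂},
      Torus.pairing (u : Lp (EuclideanSpace ℝ (Fin 3)) 2 (volume : Measure (UnitAddTorus (Fin 3)))) f
        ∂((2 : ℝ≥0∞)⁻¹ • μ + (2 : ℝ≥0∞)⁻¹ • μ.map (MeasurableEquiv.neg (Torus.energySpace (Fin 3)))) = 0 := by
  set T := MeasurableEquiv.neg (Torus.energySpace (Fin 3)) with hT
  have hTapply : ∀ u : Torus.energySpace (Fin 3), T u = -u := fun u => rfl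
  set S : Set (Torus.energySpace (Fin 3)) := {u | e₁ ≤ ‖u‖ₑ ^ 2 ∧ ‖u‖ₑ ^ 2 < e₂} with hS
  set g : Torus.energySpace (Fin 3) → ℝ := fun u =>
    Torus.pairing (u : Lp (EuclideanSpace ℝ (Fin 3)) 2 (volume : Measure (UnitAddTorus (Fin 3)))) f with hg
  have hpre : T ⁻¹' S = S := by
    ext u
    simp only [hS, Set.mem_preimage, Set.mem_setOf_eq, hTapply, enorm_neg]
  have hrestr : ((2 : ℝ≥0∞)⁻¹ • μ + (2 : ℝ≥0∞)⁻¹ • μ.map T).restrict S =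
      (2 : ℝ≥0∞)⁻¹ • μ.restrict S + (2 : ℝ≥0∞)⁻¹ • (μ.restrict S).map T := by
    simp only [Measure.restrict_add, Measure.restrict_smul]
    rw [T.measurableEmbedding.restrict_map, hpre]
  change ∫ u in S, g u ∂((2 : ℝ≥0∞)⁻¹ • μ + (2 : ℝ≥0∞)⁻¹ • μ.map T) = 0
  rw [hrestr]
  by_cases hint : Integrable g ((2 : ℝ≥0∞)⁻¹ • μ.restrict S + (2 : ℝ≥0∞)⁻¹ • (μ.restrict S).map T)
  · have h1 : Integrable g ((2 : ℝ≥0∞)⁻¹ • μ.restrict S) := hint.mono_measure (Measure.le_add_right le_rfl)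
    have h2 : Integrable g ((2 : ℝ≥0∞)⁻¹ • (μ.restrict S).map T) := hint.mono_measure (Measure.le_add_left le_rfl)
    rw [integral_add_measure h1 h2, integral_smul_measure, integral_smul_measure, integral_map_equiv]
    simp only [hg, hTapply, pairing_neg_state, integral_neg, smul_eq_mul, mul_neg, add_neg_cancel]
  · rw [integral_undef hint]

/-- **The shell clause is not load-bearing**: `N` is equivalent to `N` with clause shell DELETED, i.e. to the pure
Liouville non-existence statement (prob ∧ fin ∧ liouville impossible). So the shell inequality cannot be the
hypothesis a proof of `N` turns on, and no `_false_without_shell` lemma exists unless `N` itself fails. -/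
theorem gpEulerCoercive_iff_withoutShell :
    GPEulerCoercive ↔ ∀ μ : Measure (Torus.energySpace (Fin 3)),
      ¬ (IsProbabilityMeasure μ ∧
        (∫⁻ u, Torus.eGradNormSq ((u : Lp (EuclideanSpace ℝ (Fin 3)) 2 (volume : Measure (UnitAddTorus (Fin 3)))) :
            UnitAddTorus (Fin 3) → EuclideanSpace ℝ (Fin 3)) ∂μ < ∞) ∧
        (∀ Φ : Torus.CylindricalTest (Fin 3),
          Integrable (fun u : Torus.energySpace (Fin 3) => Torus.nsGeneratorPairing 0 gpForce u (Φ.grad u)) μ ∧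
            ∫ u, Torus.nsGeneratorPairing 0 gpForce u (Φ.grad u) ∂μ = 0)) := by
  rw [gpEulerCoercive_iff]
  constructor
  · rintro h μ ⟨hp, hfin, hL⟩
    exact h _ (isSSS_symmetrize hfin hL)
  · intro h μ hμ
    exact h μ ⟨hμ.prob, hμ.enstrophy_finite, hμ.generator⟩

/-- The same in curried form — the Liouville-only statement consumed by weak duality (stub W of line
`floor-duality-galerkin` needs only prob ∧ fin ∧ liouville). -/
theorem gpEulerCoercive_iff_noLiouville :
    GPEulerCoercive ↔ ∀ μ : Measure (Torus.energySpace (Fin 3)), IsProbabilityMeasure μ →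
      (∫⁻ u, Torus.eGradNormSq ((u : Lp (EuclideanSpace ℝ (Fin 3)) 2 (volume : Measure (UnitAddTorus (Fin 3)))) :
          UnitAddTorus (Fin 3) → EuclideanSpace ℝ (Fin 3)) ∂μ < ∞) →
      ¬ (∀ Φ : Torus.CylindricalTest (Fin 3),
          Integrable (fun u : Torus.energySpace (Fin 3) => Torus.nsGeneratorPairing 0 gpForce u (Φ.grad u)) μ ∧
            ∫ u, Torus.nsGeneratorPairing 0 gpForce u (Φ.grad u) ∂μ = 0) := by
  rw [gpEulerCoercive_iff_withoutShell]
  exact ⟨fun h μ hp hfin hL => h μ ⟨hp, hfin, hL⟩, fun h μ ⟨hp, hfin, hL⟩ => h μ hp hfin hL⟩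

/-- **WLOG even.** If `f_GP` carries any stationary Euler statistics, it carries one that is invariant under
`u ↦ −u` and does zero work on every energy shell — the normal form every line may assume. -/
theorem exists_even_sss_of_not_gpEulerCoercive (h : ¬ GPEulerCoercive) :
    ∃ μ : Measure (Torus.energySpace (Fin 3)), Torus.IsStationaryStatisticalSolution 0 gpForce μ ∧
      μ.map (MeasurableEquiv.neg (Torus.energySpace (Fin 3))) = μ ∧
      ∀ e₁ e₂ : ℝ≥0∞, ∫ u in {u : Torus.energySpace (Fin 3) | e₁ ≤ ‖u‖ₑ ^ 2 ∧ ‖u‖ₑ ^ 2 < e₂},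
        Torus.pairing (u : Lp (EuclideanSpace ℝ (Fin 3)) 2 (volume : Measure (UnitAddTorus (Fin 3)))) gpForce ∂μ = 0 := by
  obtain ⟨μ, hμ⟩ := not_gpEulerCoercive_iff.mp h
  haveI := hμ.prob
  set T := MeasurableEquiv.neg (Torus.energySpace (Fin 3)) with hT
  refine ⟨(2 : ℝ≥0∞)⁻¹ • μ + (2 : ℝ≥0∞)⁻¹ • μ.map T, isSSS_symmetrize hμ.enstrophy_finite hμ.generator, ?_,
    shellWork_symmetrize_eq_zero gpForce μ⟩
  have hinv : (μ.map T).map T = μ := by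
    rw [Measure.map_map T.measurable T.measurable]
    have : ((T : Torus.energySpace (Fin 3) → Torus.energySpace (Fin 3)) ∘ T) = id := by
      funext u; simp [hT]
    rw [this, Measure.map_id]
  rw [Measure.map_add _ _ T.measurable, Measure.map_smul, Measure.map_smul, hinv, add_comm]

end Summit.AnomalousDissipation.AnomalousDissipation.Theorems.GPEulerCoercive.Negative
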